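import Summits.Ventures.PercRepro.Night2LocalCovering

/-!
# PercRepro — the coloops of a far trace lie in the member (night-2, gen 8)

FACT F1 of `proofs/NIGHT-2-local.md` §17(e): if `B` is a bottom set below the rank-`(q+1)` flat `G` and
`Z ⊆ G ∖ cl B` has at least two elements, then every coloop of the far trace `B ∪ Z` lies in `B` and is a coloop
of `B` (**`coloops_union_subset`**); hence `B ∪ Z` has at most `q` coloops (**`card_coloops_union_le`**) and at
most `q` covering preimages (**`card_coverPreimages_union_le`**) — a far trace is never «full».

Proof.  For `z ∈ Z` pick `z' ∈ Z ∖ {z}`: `B ∪ {z'}` already spans `G ∋ z` (`clF_insert_eq_iff`), so `z` lies in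
the closure of `(B ∪ Z) ∖ {z}`.  For `x ∈ B`, the closure of `(B ∪ Z) ∖ {x}` contains that of `B ∖ {x}`.
-/

namespace PercRepro.Shadow

open Finset PerFlat ThmH

variable {α : Type*} [DecidableEq α] {M : Matroid α} [M.Finite]

omit [DecidableEq α] in
/-- `clF` is monotone. -/
theorem clF_mono {X Y : Finset α} (h : X ⊆ Y) : clF M X ⊆ clF M Y := by
  rw [← Finset.coe_subset, coe_clF, coe_clF]
  exact M.closure_mono (by exact_mod_cast h)

/-- A covering set `B ∪ {z}` of a bottom set below `G` has closure `G`. -/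
theorem clF_insert_eq_of_mem_sdiff {q : ℕ} {G : Finset α} (hG : G ∈ flatsQ M (q + 1)) {B : Finset α}
    (hB : B ∈ Uq M (q + 2) q) (hBG : clF M B ⊆ G) {z : α} (hz : z ∈ G \ clF M B) :
    clF M (insert z B) = G := by
  have hF : clF M B ∈ flatsQ M q := clF_mem_flatsQ hB
  have hzE : z ∈ gr M \ clF M B := by
    rw [Finset.mem_sdiff] at hz ⊢
    exact ⟨(mem_flatsQ.1 hG).1 hz.1, hz.2⟩
  have h1 : clF M (insert z (clF M B)) = G := (clF_insert_eq_iff hF hG hBG hzE).2 (Finset.mem_sdiff.1 hz).1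
  -- clF (insert z B) = clF (insert z (clF B))
  have h2 : clF M (insert z B) = clF M (insert z (clF M B)) := by
    rw [← Finset.coe_inj, coe_clF, coe_clF, Finset.coe_insert, Finset.coe_insert, coe_clF,
      Matroid.closure_insert_closure_eq_closure_insert]
  rw [h2, h1]

/-- **FACT F1.**  The coloops of a far trace `B ∪ Z` (`Z ⊆ G ∖ cl B`, `|Z| ≥ 2`) are coloops of `B`. -/
theorem coloops_union_subset {q : ℕ} {G : Finset α} (hG : G ∈ flatsQ M (q + 1)) {B : Finset α}
    (hB : B ∈ Uq M (q + 2) q) (hBG : clF M B ⊆ G) {Z : Finset α} (hZ : Z ⊆ G \ clF M B) (h2 : 2 ≤ Z.card) :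
    coloops M (B ∪ Z) ⊆ coloops M B := by
  intro x hx
  rw [mem_coloops] at hx ⊢
  obtain ⟨hxBZ, hxcl⟩ := hx
  rw [Finset.mem_union] at hxBZ
  rcases hxBZ with hxB | hxZ
  · refine ⟨hxB, fun h => hxcl ?_⟩
    exact clF_mono (Finset.erase_subset_erase x (Finset.subset_union_left)) h
  · exfalso
    -- a second element of Z
    obtain ⟨z', hz'Z, hz'x⟩ : ∃ z' ∈ Z, z' ≠ x := by
      by_contra hcon
      push Not at hcon
      have : Z ⊆ {x} := fun y hy => Finset.mem_singleton.2 (hcon y hy)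
      have := Finset.card_le_card this
      rw [Finset.card_singleton] at this
      omega
    apply hxcl
    have hsub : insert z' B ⊆ (B ∪ Z).erase x := by
      intro e he
      rw [Finset.mem_insert] at he
      rw [Finset.mem_erase, Finset.mem_union]
      rcases he with rfl | heB
      · exact ⟨hz'x, Or.inr hz'Z⟩
      · refine ⟨fun h => ?_, Or.inl heB⟩
        rw [h] at heB
        exact (Finset.mem_sdiff.1 (hZ hxZ)).2 (subset_clF hB heB)
    have hcl : clF M (insert z' B) = G := clF_insert_eq_of_mem_sdiff hG hB hBG (hZ hz'Z)
    have hxG : x ∈ G := (Finset.mem_sdiff.1 (hZ hxZ)).1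
    exact clF_mono hsub (hcl ▸ hxG)

/-- A far trace has at most `q` coloops. -/
theorem card_coloops_union_le {q : ℕ} {G : Finset α} (hG : G ∈ flatsQ M (q + 1)) {B : Finset α}
    (hB : B ∈ Uq M (q + 2) q) (hBG : clF M B ⊆ G) {Z : Finset α} (hZ : Z ⊆ G \ clF M B) (h2 : 2 ≤ Z.card) :
    (coloops M (B ∪ Z)).card ≤ q := by
  have hBE : B ⊆ gr M := (mem_Uq.1 hB).1
  have hZE : Z ⊆ gr M := fun z hz => (mem_flatsQ.1 hG).1 (Finset.mem_sdiff.1 (hZ hz)).1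
  have hind : M.Indep ((coloops M (B ∪ Z) : Finset α) : Set α) := indep_coloops (Finset.union_subset hBE hZE)
  have hsub : coloops M (B ∪ Z) ⊆ B :=
    (coloops_union_subset hG hB hBG hZ h2).trans (Finset.filter_subset _ _)
  have h := hind.encard_le_eRk_of_subset (by exact_mod_cast hsub)
  rw [Set.encard_coe_eq_coe_finsetCard, (mem_Uq.1 hB).2.1] at h
  exact_mod_cast h

open scoped Classical in
/-- A far trace has at most `q` covering preimages in any family. -/
theorem card_coverPreimages_union_le {q : ℕ} {𝒜 : Finset (Finset α)} (h𝒜 : 𝒜 ⊆ Uq M (q + 2) q) {G : Finset α}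
    (hG : G ∈ flatsQ M (q + 1)) {B : Finset α} (hB : B ∈ Uq M (q + 2) q) (hBG : clF M B ⊆ G) {Z : Finset α}
    (hZ : Z ⊆ G \ clF M B) (h2 : 2 ≤ Z.card) :
    (coverPreimages M 𝒜 G (B ∪ Z)).card ≤ q :=
  (card_coverPreimages_le_card_coloops h𝒜 G (B ∪ Z)).trans (card_coloops_union_le hG hB hBG hZ h2)

end PercRepro.Shadow
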